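import Mathlib
import HarnessLib
import Summits.Ventures.LatticeQCDFlow.Scoring.OnePlaquetteBessel
import Summits.Ventures.LatticeQCDFlow.Scaling.AcceptanceVolumeDecayPi
import Summits.Ventures.LatticeQCDFlow.Scaling.AcceptanceEssEightNinthsWeight

/-!
# LatticeQCDFlow / Scaling — the UNTRAINED (identity-flow) baseline of the factorised SU(2) sampler
# in closed form (class angle): `ESS_V = (2Z₂(β)²/(πZ₂(2β)))^V = (4I₁(β)²/(βI₁(2β)))^V`,
# `(8/9)·ESS_V ≤ acc_V ≤ (2Z₂(β/2)²/(πZ₂(β)))^V`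

HONEST FRAMING: exact (Metropolis-corrected) sampling algorithms for lattice gauge theory;
figures of merit are autocorrelation/cost numbers at stated couplings and volumes; no
continuum-physics claim.

Venture `LatticeQCDFlow` (cell pub-lqcd), topic `Scaling`; FANOUT row 3 (`s0-u1-a`, GEN-12) — the
SU(2) twin of `Scaling/U1IdentityFlowVolumeLaw` for the SU(2) rows' untrained baseline.  NEW WORK of
the cell (closed forms, no numerics).  The exact sampler proposes each of `V` independent
plaquette variables from Haar on SU(2) and Metropolis-corrects against the one-plaquette Wilson
weight `e^{(β/2) tr U} = e^{β cos α}` (`α` the class angle).  Acceptance and effective sample size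
of an independence sampler depend only on the law of the importance weight under the model, and the
weight `e^{β cos α}/c(β)` is a class function, so both are computed EXACTLY in the class-angle
chart: reference measure Lebesgue on `(0, π]`, Haar class density `q(α) = (2/π) sin² α`, Wilson
class density `p_β(α) = sin² α e^{β cos α}/Z₂(β)` with row 5's
`Z₂(β) = ∫₀^π sin² α e^{β cos α} dα` (`β·Z₂(β) = π I₁(β)`, `Scoring.beta_mul_onePlaquetteZSU2`,
imported), and the explicit weight `b_β(α) = (π/2) e^{β cos α}/Z₂(β)` (`b_β·q = p_β`; the model
density vanishes at `α = π`, which is why the weight is carried explicitly and the 8/9 floor is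
taken from `Scaling/AcceptanceEssEightNinthsWeight`, imported).  As for U(1), the product model
is the 2-d theory with OPEN boundary conditions in a complete axial gauge (independent plaquette
variables); the periodic torus is NOT claimed.

* one plaquette: `integral_su2Haar` (`∫ q = 1`), `integral_su2Wilson` (`∫ p_β = 1`),
  **`integral_su2Weight_mul_Wilson`** (`W₁ = ∫ b_β p_β = (π/2)·Z₂(2β)/Z₂(β)²`, i.e.
  `ESS₁ = 2Z₂(β)²/(π Z₂(2β))`), `su2_sq_div_eq_weight_mul` (`p_β²/q = b_β p_β` pointwise, the
  chart's removable zero included), **`integral_sqrt_su2Wilson_mul_sq`**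
  (`BC₁² = (∫ √(p_β q))² = 2Z₂(β/2)²/(π Z₂(β))`);
* **`su2IdentityFlow_essFrac`** — `ESS_V = (2Z₂(β)²/(πZ₂(2β)))^V` EXACTLY;
* **`su2IdentityFlow_meanAccept_mem_Icc`** —
  `(8/9)·(2Z₂(β)²/(πZ₂(2β)))^V ≤ acc_V ≤ (2Z₂(β/2)²/(πZ₂(β)))^V`;
* `su2_essFrac_one_besselI` — for `β > 0` the Bessel form `ESS₁ = 4 I₁(β)²/(β I₁(2β))`.

Reading (value-free; no number of ours is computed or implied): the untrained exact SU(2) sampler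
of the factorised model has ESS decaying geometrically in the number of plaquettes with ratio
`4I₁(β)²/(βI₁(2β))` (three Haar directions instead of one: `∼ 4/(√π β^{3/2})` as `β → ∞`, against
U(1)'s `(πβ)^{-1/2}`), with the acceptance pinned within `9/8` of it below.  NOT CLAIMED: the
periodic-torus constraint; any value at the cell's couplings; nothing re-scored.
-/

namespace Summit.Ventures.LatticeQCDFlow.Theory2

open MeasureTheory Real Set Finset
open Literature.Analysis.FunctionSpaces (besselI hasSum_besselI)
open Summit.Ventures.LatticeQCDFlow.Scoring (onePlaquetteZSU2 onePlaquetteZSU2_pos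
  beta_mul_onePlaquetteZSU2)

/-! ## One plaquette in the class-angle chart `(0, π]` -/

section OnePlaquette

/-- `∫_{(0,π]} sin² α e^{γ cos α} dα = Z₂(γ)`. [folklore] -/
theorem integral_Ioc_sin_sq_mul_exp (γ : ℝ) :
    ∫ α in Ioc (0 : ℝ) π, Real.sin α ^ 2 * Real.exp (γ * Real.cos α) = onePlaquetteZSU2 γ := by
  rw [onePlaquetteZSU2, intervalIntegral.integral_of_le Real.pi_pos.le]

/-- `sin² α · e^{γ cos α}` is integrable on `(0, π]`. [folklore] -/
theorem integrableOn_sin_sq_mul_exp (γ : ℝ) :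
    Integrable (fun α : ℝ => Real.sin α ^ 2 * Real.exp (γ * Real.cos α))
      (volume.restrict (Ioc (0 : ℝ) π)) :=
  (((Real.continuous_sin.pow 2).mul (Real.continuous_exp.comp
    (continuous_const.mul Real.continuous_cos))).integrableOn_Icc).mono_set Ioc_subset_Icc_self

/-- The Haar class density `(2/π) sin² α` integrates to `1` on `(0, π]`. [folklore] -/
theorem integral_su2Haar : ∫ α in Ioc (0 : ℝ) π, 2 / π * Real.sin α ^ 2 = 1 := by
  rw [integral_const_mul, ← intervalIntegral.integral_of_le Real.pi_pos.le, integral_sin_sq,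
    Real.sin_zero, Real.sin_pi]
  field_simp
  ring

/-- The Haar class density is integrable on `(0, π]`. [folklore] -/
theorem integrable_su2Haar :
    Integrable (fun α : ℝ => 2 / π * Real.sin α ^ 2) (volume.restrict (Ioc (0 : ℝ) π)) :=
  ((continuous_const.mul (Real.continuous_sin.pow 2)).integrableOn_Icc).mono_set
    Ioc_subset_Icc_self

/-- The Wilson class density is nonnegative. [folklore] -/
theorem su2Wilson_nonneg (β α : ℝ) :
    0 ≤ Real.sin α ^ 2 * Real.exp (β * Real.cos α) / onePlaquetteZSU2 β :=
  div_nonneg (mul_nonneg (sq_nonneg _) (Real.exp_pos _).le) (onePlaquetteZSU2_pos β).le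

/-- The Wilson class density is measurable. [folklore] -/
theorem measurable_su2Wilson (β : ℝ) :
    Measurable fun α : ℝ => Real.sin α ^ 2 * Real.exp (β * Real.cos α) / onePlaquetteZSU2 β :=
  (((Real.continuous_sin.pow 2).mul (Real.continuous_exp.comp
    (continuous_const.mul Real.continuous_cos))).div_const _).measurable

/-- The Wilson class density is integrable on `(0, π]`. [folklore] -/
theorem integrable_su2Wilson (β : ℝ) :
    Integrable (fun α : ℝ => Real.sin α ^ 2 * Real.exp (β * Real.cos α) / onePlaquetteZSU2 β)
      (volume.restrict (Ioc (0 : ℝ) π)) :=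
  (integrableOn_sin_sq_mul_exp β).div_const _

/-- `∫ p_β = 1`. [folklore] -/
theorem integral_su2Wilson (β : ℝ) :
    ∫ α in Ioc (0 : ℝ) π, Real.sin α ^ 2 * Real.exp (β * Real.cos α) / onePlaquetteZSU2 β = 1 := by
  rw [integral_div, integral_Ioc_sin_sq_mul_exp, div_self (onePlaquetteZSU2_pos β).ne']

/-- The weight `b_β = (π/2) e^{β cos α}/Z₂(β)` is nonnegative and measurable, and `b_β·q = p_β`.
[folklore] -/
theorem su2Weight_facts (β : ℝ) :
    (∀ α : ℝ, 0 ≤ π / 2 * Real.exp (β * Real.cos α) / onePlaquetteZSU2 β) ∧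
    Measurable (fun α : ℝ => π / 2 * Real.exp (β * Real.cos α) / onePlaquetteZSU2 β) ∧
    ∀ α : ℝ, π / 2 * Real.exp (β * Real.cos α) / onePlaquetteZSU2 β * (2 / π * Real.sin α ^ 2)
      = Real.sin α ^ 2 * Real.exp (β * Real.cos α) / onePlaquetteZSU2 β := by
  refine ⟨fun α => div_nonneg (mul_nonneg (by positivity) (Real.exp_pos _).le)
    (onePlaquetteZSU2_pos β).le, ?_, fun α => ?_⟩
  · exact ((continuous_const.mul (Real.continuous_exp.comp
      (continuous_const.mul Real.continuous_cos))).div_const _).measurable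
  · have hZ := (onePlaquetteZSU2_pos β).ne'
    field_simp

/-- **`p_β²/q = b_β·p_β` pointwise** (at the chart's zero `sin α = 0` both sides vanish; Lean's
`x/0 = 0`). [folklore] -/
theorem su2_sq_div_eq_weight_mul (β α : ℝ) :
    (Real.sin α ^ 2 * Real.exp (β * Real.cos α) / onePlaquetteZSU2 β) ^ 2 / (2 / π * Real.sin α ^ 2)
      = π / 2 * Real.exp (β * Real.cos α) / onePlaquetteZSU2 β
        * (Real.sin α ^ 2 * Real.exp (β * Real.cos α) / onePlaquetteZSU2 β) := by
  have hZ := (onePlaquetteZSU2_pos β).ne'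
  by_cases hs : Real.sin α = 0
  · simp [hs]
  · field_simp

/-- **`W₁ = ∫ b_β p_β = (π/2)·Z₂(2β)/Z₂(β)²`** — the second weight moment of one plaquette, so that
`ESS₁ = 2 Z₂(β)²/(π Z₂(2β))`. [ours] -/
theorem integral_su2Weight_mul_Wilson (β : ℝ) :
    ∫ α in Ioc (0 : ℝ) π, π / 2 * Real.exp (β * Real.cos α) / onePlaquetteZSU2 β
        * (Real.sin α ^ 2 * Real.exp (β * Real.cos α) / onePlaquetteZSU2 β)
      = π / 2 * onePlaquetteZSU2 (2 * β) / onePlaquetteZSU2 β ^ 2 := by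
  have e : ∀ α : ℝ, π / 2 * Real.exp (β * Real.cos α) / onePlaquetteZSU2 β
      * (Real.sin α ^ 2 * Real.exp (β * Real.cos α) / onePlaquetteZSU2 β)
      = π / 2 / onePlaquetteZSU2 β ^ 2 * (Real.sin α ^ 2 * Real.exp (2 * β * Real.cos α)) := by
    intro α
    have h2 : Real.exp (2 * β * Real.cos α) = Real.exp (β * Real.cos α) * Real.exp (β * Real.cos α) := by
      rw [← Real.exp_add]; ring_nf
    rw [h2]
    field_simp
  simp_rw [e]
  rw [integral_const_mul, integral_Ioc_sin_sq_mul_exp (2 * β)]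
  field_simp

/-- `b_β·p_β` is integrable on `(0, π]`. [folklore] -/
theorem integrable_su2Weight_mul_Wilson (β : ℝ) :
    Integrable (fun α : ℝ => π / 2 * Real.exp (β * Real.cos α) / onePlaquetteZSU2 β
        * (Real.sin α ^ 2 * Real.exp (β * Real.cos α) / onePlaquetteZSU2 β))
      (volume.restrict (Ioc (0 : ℝ) π)) := by
  have e : ∀ α : ℝ, π / 2 * Real.exp (β * Real.cos α) / onePlaquetteZSU2 β
      * (Real.sin α ^ 2 * Real.exp (β * Real.cos α) / onePlaquetteZSU2 β)
      = π / 2 / onePlaquetteZSU2 β ^ 2 * (Real.sin α ^ 2 * Real.exp (2 * β * Real.cos α)) := by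
    intro α
    have h2 : Real.exp (2 * β * Real.cos α) = Real.exp (β * Real.cos α) * Real.exp (β * Real.cos α) := by
      rw [← Real.exp_add]; ring_nf
    rw [h2]
    field_simp
  simp_rw [e]
  exact (integrableOn_sin_sq_mul_exp (2 * β)).const_mul _

/-- **`BC₁² = (∫ √(p_β q))² = 2 Z₂(β/2)²/(π Z₂(β))`** — the squared block affinity. [ours] -/
theorem integral_sqrt_su2Wilson_mul_sq (β : ℝ) :
    (∫ α in Ioc (0 : ℝ) π, Real.sqrt (Real.sin α ^ 2 * Real.exp (β * Real.cos α)
        / onePlaquetteZSU2 β * (2 / π * Real.sin α ^ 2))) ^ 2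
      = 2 * onePlaquetteZSU2 (β / 2) ^ 2 / (π * onePlaquetteZSU2 β) := by
  have hZ := onePlaquetteZSU2_pos β
  have e : ∀ α : ℝ, Real.sqrt (Real.sin α ^ 2 * Real.exp (β * Real.cos α) / onePlaquetteZSU2 β
      * (2 / π * Real.sin α ^ 2))
      = Real.sqrt (2 / (π * onePlaquetteZSU2 β)) * (Real.sin α ^ 2 * Real.exp (β / 2 * Real.cos α)) := by
    intro α
    have hx : Real.sin α ^ 2 * Real.exp (β * Real.cos α) / onePlaquetteZSU2 β * (2 / π * Real.sin α ^ 2)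
        = 2 / (π * onePlaquetteZSU2 β) * (Real.sin α ^ 2 * Real.exp (β / 2 * Real.cos α)) ^ 2 := by
      have h2 : Real.exp (β * Real.cos α)
          = Real.exp (β / 2 * Real.cos α) * Real.exp (β / 2 * Real.cos α) := by
        rw [← Real.exp_add]; ring_nf
      rw [h2]
      field_simp
    rw [hx, Real.sqrt_mul' _ (sq_nonneg _),
      Real.sqrt_sq (mul_nonneg (sq_nonneg _) (Real.exp_pos _).le)]
  simp_rw [e]
  rw [integral_const_mul, integral_Ioc_sin_sq_mul_exp (β / 2), mul_pow,
    Real.sq_sqrt (by positivity)]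
  field_simp

/-- **`ESS₁ = 2Z₂(β)²/(πZ₂(2β))`** in the density form `(∫p)²/∫p²/q`. [ours] -/
theorem su2IdentityFlow_essFrac_one (β : ℝ) :
    (∫ α in Ioc (0 : ℝ) π, Real.sin α ^ 2 * Real.exp (β * Real.cos α) / onePlaquetteZSU2 β) ^ 2
        / ∫ α in Ioc (0 : ℝ) π, (Real.sin α ^ 2 * Real.exp (β * Real.cos α)
            / onePlaquetteZSU2 β) ^ 2 / (2 / π * Real.sin α ^ 2)
      = 2 * onePlaquetteZSU2 β ^ 2 / (π * onePlaquetteZSU2 (2 * β)) := by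
  simp_rw [su2_sq_div_eq_weight_mul]
  rw [integral_su2Wilson, integral_su2Weight_mul_Wilson]
  have hZ := (onePlaquetteZSU2_pos β).ne'
  have hZ2 := (onePlaquetteZSU2_pos (2 * β)).ne'
  field_simp

/-- **Bessel form for `β > 0`**: `ESS₁ = 2Z₂(β)²/(πZ₂(2β)) = 4 I₁(β)²/(β I₁(2β))`
(`Z₂(β) = π I₁(β)/β`). [ours] -/
theorem su2_essFrac_one_besselI {β : ℝ} (hβ : 0 < β) :
    2 * onePlaquetteZSU2 β ^ 2 / (π * onePlaquetteZSU2 (2 * β))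
      = 4 * besselI 1 β ^ 2 / (β * besselI 1 (2 * β)) := by
  have hI : ∀ {x : ℝ}, 0 < x → 0 < besselI 1 x := fun {x} hx => by
    rw [← (hasSum_besselI 1 x).tsum_eq]
    exact (hasSum_besselI 1 x).summable.tsum_pos (fun k => by positivity) 0 (by positivity)
  have h1 : onePlaquetteZSU2 β = π * besselI 1 β / β := by
    rw [eq_div_iff hβ.ne', mul_comm, beta_mul_onePlaquetteZSU2]
  have h2 : onePlaquetteZSU2 (2 * β) = π * besselI 1 (2 * β) / (2 * β) := by
    rw [eq_div_iff (by positivity), mul_comm, beta_mul_onePlaquetteZSU2]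
  rw [h1, h2]
  have hI1 := (hI hβ).ne'
  have hI2 := (hI (by positivity : 0 < 2 * β)).ne'
  field_simp
  ring

end OnePlaquette

/-! ## `V` independent plaquettes -/

section Plaquettes

variable {ι : Type*} [Fintype ι]

/-- **`ESS_V = (2Z₂(β)²/(πZ₂(2β)))^V` EXACTLY** for the identity flow on `V = card ι` independent
SU(2) plaquettes (class-angle chart). [ours] -/
theorem su2IdentityFlow_essFrac (β : ℝ) :
    (∫ x, ∏ i : ι, Real.sin (x i) ^ 2 * Real.exp (β * Real.cos (x i)) / onePlaquetteZSU2 β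
        ∂(Measure.pi fun _ : ι => volume.restrict (Ioc (0 : ℝ) π))) ^ 2
      / ∫ x, (∏ i : ι, Real.sin (x i) ^ 2 * Real.exp (β * Real.cos (x i)) / onePlaquetteZSU2 β) ^ 2
          / ∏ i : ι, (2 / π * Real.sin (x i) ^ 2)
        ∂(Measure.pi fun _ : ι => volume.restrict (Ioc (0 : ℝ) π))
      = (2 * onePlaquetteZSU2 β ^ 2 / (π * onePlaquetteZSU2 (2 * β))) ^ Fintype.card ι := by
  rw [essFrac_pi_const (ι := ι) (ν := volume.restrict (Ioc (0 : ℝ) π))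
    (fun α => Real.sin α ^ 2 * Real.exp (β * Real.cos α) / onePlaquetteZSU2 β)
    (fun α => 2 / π * Real.sin α ^ 2), su2IdentityFlow_essFrac_one]

/-- **THE SU(2) IDENTITY-FLOW ACCEPTANCE SANDWICH**: for `V = card ι` independent plaquettes,
`(8/9)·(2Z₂(β)²/(πZ₂(2β)))^V ≤ acc_V ≤ (2Z₂(β/2)²/(πZ₂(β)))^V` (floor: the 8/9 law with the
explicit product weight `⊗ b_β`; ceiling: the Bhattacharyya volume law). [ours] -/
theorem su2IdentityFlow_meanAccept_mem_Icc (β : ℝ) :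
    ∫ x, ∫ x', min ((∏ i : ι, Real.sin (x i) ^ 2 * Real.exp (β * Real.cos (x i)) / onePlaquetteZSU2 β)
          * ∏ i : ι, (2 / π * Real.sin (x' i) ^ 2))
        ((∏ i : ι, Real.sin (x' i) ^ 2 * Real.exp (β * Real.cos (x' i)) / onePlaquetteZSU2 β)
          * ∏ i : ι, (2 / π * Real.sin (x i) ^ 2))
        ∂(Measure.pi fun _ : ι => volume.restrict (Ioc (0 : ℝ) π))
        ∂(Measure.pi fun _ : ι => volume.restrict (Ioc (0 : ℝ) π))
      ∈ Set.Icc (8 / 9 * (2 * onePlaquetteZSU2 β ^ 2 / (π * onePlaquetteZSU2 (2 * β))) ^ Fintype.card ι)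
          ((2 * onePlaquetteZSU2 (β / 2) ^ 2 / (π * onePlaquetteZSU2 β)) ^ Fintype.card ι) := by
  set ν : Measure ℝ := volume.restrict (Ioc (0 : ℝ) π) with hν
  have hp0 : ∀ α : ℝ, 0 ≤ Real.sin α ^ 2 * Real.exp (β * Real.cos α) / onePlaquetteZSU2 β :=
    su2Wilson_nonneg β
  have hq0 : ∀ α : ℝ, 0 ≤ 2 / π * Real.sin α ^ 2 := fun α => by positivity
  have hpm := measurable_su2Wilson β
  have hqm : Measurable fun α : ℝ => 2 / π * Real.sin α ^ 2 :=
    (continuous_const.mul (Real.continuous_sin.pow 2)).measurable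
  have hpi := integrable_su2Wilson β
  have hqi := integrable_su2Haar
  obtain ⟨hb0, hbm, hbq⟩ := su2Weight_facts β
  constructor
  · -- floor: the 8/9 law with the explicit product weight `B = ⊗ b_β`
    obtain ⟨hP0, hPm, hPi, hP1⟩ := piDensity_facts (ι := ι) (μ := fun _ : ι => ν)
      (p := fun _ α => Real.sin α ^ 2 * Real.exp (β * Real.cos α) / onePlaquetteZSU2 β)
      (fun _ => hp0) (fun _ => hpm) fun _ => hpi
    obtain ⟨hQ0, hQm, hQi, hQ1⟩ := piDensity_facts (ι := ι) (μ := fun _ : ι => ν)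
      (p := fun _ α => 2 / π * Real.sin α ^ 2) (fun _ => hq0) (fun _ => hqm) fun _ => hqi
    have hbi : Integrable (fun α : ℝ => π / 2 * Real.exp (β * Real.cos α) / onePlaquetteZSU2 β) ν :=
      (((continuous_const.mul (Real.continuous_exp.comp
        (continuous_const.mul Real.continuous_cos))).div_const _).integrableOn_Icc).mono_set
        Ioc_subset_Icc_self
    obtain ⟨hB0, hBm, -, -⟩ := piDensity_facts (ι := ι) (μ := fun _ : ι => ν)
      (p := fun _ α => π / 2 * Real.exp (β * Real.cos α) / onePlaquetteZSU2 β)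
      (fun _ => hb0) (fun _ => hbm) fun _ => hbi
    rw [prod_eq_one fun i _ => integral_su2Haar] at hQ1
    rw [prod_eq_one fun i _ => integral_su2Wilson β] at hP1
    have hBQ : ∀ x : ι → ℝ, (∏ i, π / 2 * Real.exp (β * Real.cos (x i)) / onePlaquetteZSU2 β)
        * (∏ i, 2 / π * Real.sin (x i) ^ 2)
        = ∏ i, Real.sin (x i) ^ 2 * Real.exp (β * Real.cos (x i)) / onePlaquetteZSU2 β := by
      intro x
      rw [← prod_mul_distrib]
      exact prod_congr rfl fun i _ => hbq (x i)
    have hWint : ∀ x : ι → ℝ, (∏ i, π / 2 * Real.exp (β * Real.cos (x i)) / onePlaquetteZSU2 β)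
        * (∏ i, Real.sin (x i) ^ 2 * Real.exp (β * Real.cos (x i)) / onePlaquetteZSU2 β)
        = ∏ i, (π / 2 * Real.exp (β * Real.cos (x i)) / onePlaquetteZSU2 β
          * (Real.sin (x i) ^ 2 * Real.exp (β * Real.cos (x i)) / onePlaquetteZSU2 β)) :=
      fun x => prod_mul_distrib.symm
    have hWi : Integrable (fun x : ι → ℝ =>
        (∏ i, π / 2 * Real.exp (β * Real.cos (x i)) / onePlaquetteZSU2 β)
        * ∏ i, Real.sin (x i) ^ 2 * Real.exp (β * Real.cos (x i)) / onePlaquetteZSU2 β)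
        (Measure.pi fun _ : ι => ν) := by
      simp_rw [hWint]
      exact Integrable.fintype_prod_dep (μ := fun _ : ι => ν)
        fun _ => integrable_su2Weight_mul_Wilson β
    have hWval : ∫ x, (∏ i, π / 2 * Real.exp (β * Real.cos (x i)) / onePlaquetteZSU2 β)
        * ∏ i, Real.sin (x i) ^ 2 * Real.exp (β * Real.cos (x i)) / onePlaquetteZSU2 β
        ∂(Measure.pi fun _ : ι => ν)
        = (π / 2 * onePlaquetteZSU2 (2 * β) / onePlaquetteZSU2 β ^ 2) ^ Fintype.card ι := by
      simp_rw [hWint]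
      rw [integral_fintype_prod_eq_prod (μ := fun _ : ι => ν)
        (fun (_ : ι) (α : ℝ) => π / 2 * Real.exp (β * Real.cos α) / onePlaquetteZSU2 β
          * (Real.sin α ^ 2 * Real.exp (β * Real.cos α) / onePlaquetteZSU2 β)),
        prod_const, card_univ, integral_su2Weight_mul_Wilson]
    have hW1 : 0 < π / 2 * onePlaquetteZSU2 (2 * β) / onePlaquetteZSU2 β ^ 2 := by
      have h1 := onePlaquetteZSU2_pos (2 * β)
      have h2 := onePlaquetteZSU2_pos β
      positivity
    have hWpos : 0 < ∫ x, (∏ i, π / 2 * Real.exp (β * Real.cos (x i)) / onePlaquetteZSU2 β)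
        * ∏ i, Real.sin (x i) ^ 2 * Real.exp (β * Real.cos (x i)) / onePlaquetteZSU2 β
        ∂(Measure.pi fun _ : ι => ν) := by
      rw [hWval]
      positivity
    have h := eight_ninths_le_meanAccept_of_weight (μ := Measure.pi fun _ : ι => ν) hP0 hPm hPi hP1
      hQ0 hQm hQi hQ1 hB0 hBm hBQ hWi hWpos
    rw [hWval] at h
    have hratio : 2 * onePlaquetteZSU2 β ^ 2 / (π * onePlaquetteZSU2 (2 * β))
        = (π / 2 * onePlaquetteZSU2 (2 * β) / onePlaquetteZSU2 β ^ 2)⁻¹ := by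
      have h1 := (onePlaquetteZSU2_pos (2 * β)).ne'
      have h2 := (onePlaquetteZSU2_pos β).ne'
      field_simp
    rw [hratio, inv_pow]
    calc 8 / 9 * ((π / 2 * onePlaquetteZSU2 (2 * β) / onePlaquetteZSU2 β ^ 2) ^ Fintype.card ι)⁻¹
        = 8 / (9 * (π / 2 * onePlaquetteZSU2 (2 * β) / onePlaquetteZSU2 β ^ 2) ^ Fintype.card ι) := by
          ring
      _ ≤ _ := h
  · -- ceiling: the Bhattacharyya volume law
    have h := (meanAccept_pi_const_mem_Icc (ι := ι) (ν := ν) hp0 hpm hpi hq0 hqm hqi).2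
    rw [integral_sqrt_su2Wilson_mul_sq] at h
    exact h

end Plaquettes

end Summit.Ventures.LatticeQCDFlow.Theory2
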